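import Literature.NumberTheory.ComplexMultiplication.MainTheoremCMLevelUniformization
import Literature.NumberTheory.ComplexMultiplication.CMTypeUniformizationHoms
import Literature.NumberTheory.ComplexMultiplication.CasselmanFiniteLevelMultiplier
import Literature.AlgebraicGeometry.ComplexMultiplication.CMTypeRealisationIsogenyTransport
import Literature.AlgebraicGeometry.Motives.AbelianVarietyWeilPairingAlgClosure
import Literature.AlgebraicGeometry.Motives.AbelianVarietyWeilPairingConjugate
import Literature.AlgebraicGeometry.Motives.AbelianVarietyWeilPairingBaseChange
import Literature.AlgebraicGeometry.Motives.AbelianVarietyBaseChangeTower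
import HarnessLib

/-!
# The main theorem of complex multiplication, S7c «model reduction» (Shimura 1998, §18.6, proof of Thm. 18.6,
# p. 165 «we may assume that A, ι are rational over an algebraic number field» and p. 168 «Let X be a basic polar divisor»)

Topic `Literature/NumberTheory/ComplexMultiplication`, namespace `Literature.NumberTheory.ComplexMultiplication`.
Cell `hodgecm-mathlib` (D-0151), fan B-II, line `b2-main-theorem-cm` v2j, piece **S7c** of B-p12's kernel-checked
S7 split (`IsLevelUniformization` / `levelStructure` (S7a) / `levelGluing` (S7b) / `modelReduction` (S7c), junction
file `MainTheoremCMLevelUniformization`).  THEOREMS ONLY (no definition, no named fact; net debt 0): this file PROVES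
`modelReduction`, i.e. the reduction of the named fact `shimura1998_thm18_6` (clauses (1) [type and lattice] and (2))
to the two printed-citation facts `shimura1998_prop26_definedOverNumberField` (§12.4 Prop. 26) and
`exists_balancedDivisor_finiteExtension` (§6.2 Thm. 4 (3) + §4.1 Prop. 10) together with S7a (the level-`N`
structure) and S7b (gluing two levels).  HC_CM is proved only modulo the printed citations; this file does not
mention it further.

## The print, and how the reduction runs (Shimura 1998, pp. 127–128, 165, 168–169)

[p. 128, first lines of the proof of Thm. 18.6]: «we may assume that `𝒫` is rational over an algebraic number field.»
[p. 165]: «we may assume that `A`, `A_i`, `ι`, `η_i` are rational over an algebraic number field `k′`.»  [p. 168 L3]: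
«Let `X` be a basic polar divisor of `𝒞`.»  [p. 169]: «Now replace `M` by its multiple `N` … Thus `ξ′ = ξ″` … This
completes the proof.»

* MODEL (W(ii) = Prop. 26 + §6.2 Thm. 3, tree `exists_isCMTypeRealisationOver_uniformization_of_prop26`): for the given
  `(K, Φ, 𝔞)` there is a structure `(A₁, ι₁)` of type `(K, Φ)` over a number field `k₁ ⊂ ℂ` whose complexification is
  of type `(K, Φ, 𝔞)` with respect to some `ξ₁`.
* DIVISOR (S5b): over a finite extension `L′ ⊇ k₁` inside `ℂ` the model `A₀ := A₁ ⊗ L′` carries a Cartier divisor `X`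
  whose complex Weil pairings are Rosati-balanced for `ι` with bounded `ℓ`-radicals (here `ℓ = 2`); `(A₀, ι₀)` is again
  of type `(K, Φ)` (`IsCMTypeRealisationOver.baseChange`) and `A₀ ⊗ ℂ ≅ A₁ ⊗ ℂ` (tower) is uniformised by
  `ξ₀ := e⁻¹ ∘ ξ₁` (`CMTypeUniformization.ofIso`).
* LEVELS (S7a at the levels `N = 6` and `N′ = 6d`, S7b): S7a gives one `ν` and, for every level `N > 0` divisible by
  `ℓ`, a uniformisation `ξ′_N` of `((A₀ ⊗ ℂ)^σ, ι^σ)` of type `(K, Φ, g(s)⁻¹𝔞)` with clause (2) for `u ∈ N⁻¹𝔞`; for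
  `u ∈ K` arbitrary pick `d > 0` with `du ∈ 𝔞` (`K/𝔞` is torsion), so (2) holds for `u` at level `6d`, and S7b
  (`3 ≤ 6`, `6 ∣ 6d`, `2 ∣ 6`) says `ξ′_{6d} = ξ′_6` on `r(K)`: hence `ξ′ := ξ′_6` satisfies (2) for every `u`.
* TRANSFER (§7.4 Prop. 17, tree `CMTypeUniformization.exists_iso_forall_map_r_eq` with `b = 1`): the given complex
  structure `(A, ι, ξ)` of type `(K, Φ, 𝔞)` is isomorphic to `(A₀ ⊗ ℂ, ι₀ ⊗ ℂ, ξ₀)` by an `𝓞_K`-isomorphism `e` with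
  `e(r₀(u)) = r(u)`; conjugating `e` (`Hom.conjugate`, `(f(x))^σ = f^σ(x^σ)` = `conjPoints_map`) carries `ξ′` to a
  uniformisation `e^σ ∘ ξ′` of `(A^σ, ι^σ)` (`ofIso`) with `(r(u))^σ = (e(r₀(u)))^σ = e^σ(r₀(u)^σ) = e^σ(ξ′(q(v))))`.

## References
* [Shimura1998] G. Shimura, *Abelian Varieties with Complex Multiplication and Modular Functions*, Princeton 1998,
  §18.6 Thm. 18.6 and its proof (pp. 127–128, 164–169); §7.4 Prop. 17 (p. 58); §12.4 Prop. 26; §6.2 Thms. 3, 4.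
* [Milne2005ShimuraVarieties] J. S. Milne, *Introduction to Shimura varieties*, §11 (the functor `σ` on abelian
  varieties and their points, p. 108).
-/

noncomputable section

open CategoryTheory CategoryTheory.Limits AlgebraicGeometry NumberField IsDedekindDomain
open scoped NumberField nonZeroDivisors
open Literature.AlgebraicGeometry.Motives Literature.AlgebraicGeometry.Motives.AbelianVariety
open Literature.NumberTheory.ComplexMultiplication Literature.NumberTheory.NumberFields
open Literature.AlgebraicGeometry.ComplexMultiplication
open Literature.NumberTheory.GaloisRepresentations (ideleGroup)

namespace Literature.NumberTheory.ComplexMultiplication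

open Literature.NumberTheory.NumberFields.IdeleAction (ideleMulEquiv)

/-! ### Transfer of the conclusion of Thm. 18.6 along an isomorphism of uniformised structures -/

/-- **Transfer along `e : (B, ι_B, ξ_B) ≅ (A, ι, ξ)`.**  If `e` is an `𝓞_K`-isomorphism of complex abelian varieties
with `e(r_B(u)) = r(u)` and `ξ_B′` uniformises `(B^τ, ι_B^τ)` with type `(K, Φ, 𝔟)` and `r_B(u)^τ = r_B′(v)` whenever
`R u v`, then `e^τ ∘ ξ_B′` uniformises `(A^τ, ι^τ)` with `r(u)^τ = (e^τ ∘ r_B′)(v)` whenever `R u v` — by the naturality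
`(f(x))^τ = f^τ(x^τ)` (`conjPoints_map`) and functoriality of `f ↦ f^τ`. [cite: Shimura1998, §17.3 p. 117 (isomorphisms of structures «λ ∘ ξ»); §21.4 proof p. 192 («r(w)^σ = …»)]
[cite: Milne2005ShimuraVarieties, §11 p. 108 (the functor σ)] -/
theorem exists_uniformization_conjugate_of_iso {K : Type} [Field K] [NumberField K] {Φ : CMType K}
    {𝔞 𝔟 : (FractionalIdeal (𝓞 K)⁰ K)ˣ} {A B : AbelianVariety ℂ} {ι : 𝓞 K →+* End A} {ιB : 𝓞 K →+* End B}
    (ξB : CMTypeUniformization Φ 𝔞 B ιB) (ξ : CMTypeUniformization Φ 𝔞 A ι) (e : B ≅ A)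
    (he : ∀ a : 𝓞 K, ιB a ≫ e.hom = e.hom ≫ ι a)
    (her : ∀ u : K, AlgPoints.map e.hom.hom.hom.hom (ξB.r u) = ξ.r u) (τ : ℂ ≃+* ℂ) (R : K → K → Prop)
    (ξB' : CMTypeUniformization Φ 𝔟 (B.conjugate τ) ((B.endConjugate τ).comp ιB))
    (hB : ∀ u v : K, R u v → B.conjPoints τ (ξB.r u) = ξB'.r v) :
    ∃ ξ' : CMTypeUniformization Φ 𝔟 (A.conjugate τ) ((A.endConjugate τ).comp ι),
      ∀ u v : K, R u v → A.conjPoints τ (ξ.r u) = ξ'.r v := by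
  -- the conjugate isomorphism `e^τ : B^τ ≅ A^τ`
  let eτ : B.conjugate τ ≅ A.conjugate τ :=
    ⟨Hom.conjugate τ e.hom, Hom.conjugate τ e.inv,
      by rw [← Hom.conjugate_comp, e.hom_inv_id, Hom.conjugate_id],
      by rw [← Hom.conjugate_comp, e.inv_hom_id, Hom.conjugate_id]⟩
  have heτ : ∀ a : 𝓞 K,
      ((B.endConjugate τ).comp ιB) a ≫ eτ.hom = eτ.hom ≫ ((A.endConjugate τ).comp ι) a := fun a => by
    change Hom.conjugate τ (ιB a) ≫ Hom.conjugate τ e.hom = Hom.conjugate τ e.hom ≫ Hom.conjugate τ (ι a)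
    rw [← Hom.conjugate_comp, ← Hom.conjugate_comp, he]
  refine ⟨ξB'.ofIso eτ heτ, fun u v huv => ?_⟩
  rw [CMTypeUniformization.ofIso_r, ← her u, conjPoints_map, hB u v huv]

/-! ### The model case: S5b + S7a at two levels + S7b -/

/-- **Thm. 18.6 (1)–(2) for the complexification of a number-field model**, from S5b, S7a, S7b.  For `(A₁, ι₁)` of
type `(K, Φ)` over a number field `L ⊂ ℂ` with `A₁ ⊗ ℂ` uniformised of type `(K, Φ, 𝔞)`, and `σ = [s, K*]`: SOME complex
structure `(B, ι_B, ξ_B)` of type `(K, Φ, 𝔞)` — namely `B = (A₁ ⊗ L′) ⊗ ℂ` for S5b's finite extension `L′` — has a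
uniformisation `ξ′` of `(B^σ, ι_B^σ)` of type `(K, Φ, g(s)⁻¹𝔞)` with clause (2) for all `u ∈ K`: S7a at `ℓ = 2` and the
levels `6 ∣ 6d` (`du ∈ 𝔞`), glued by S7b («Now replace `M` by its multiple `N` … `ξ′ = ξ″`», p. 169).
[cite: Shimura1998, §18.6 proof of Thm. 18.6, pp. 165, 168–169] -/
theorem exists_model_uniformization_conjugate (h5b : exists_balancedDivisor_finiteExtension)
    (h7a : levelStructure) (h7b : levelGluing)
    {K : Type} [Field K] [NumberField K] [IsCMField K] (Φ : CMType K) [NumberField (traceField Φ)]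
    (𝔞 : (FractionalIdeal (𝓞 K)⁰ K)ˣ) {L : Type} [Field L] [NumberField L] [Algebra L ℂ]
    (A₁ : AbelianVariety L) (ι₁ : 𝓞 K →+* End A₁) (hA₁ : IsCMTypeRealisationOver Φ A₁ ι₁)
    (ξ₁ : CMTypeUniformization Φ 𝔞 (A₁.baseChange ℂ) ((A₁.endBaseChange ℂ).comp ι₁))
    (σ : ℂ ≃ₐ[traceField Φ] ℂ) (s : ideleGroup (traceField Φ)) (hs : IsArtinLift (traceField Φ) s σ) :
    ∃ (B : AbelianVariety ℂ) (ιB : 𝓞 K →+* End B) (ξB : CMTypeUniformization Φ 𝔞 B ιB)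
      (ξ' : CMTypeUniformization Φ (ideleMulIdealUnits (reflexNormFinitePart K Φ (traceField Φ) s)⁻¹ 𝔞)
        (B.conjugate σ.toRingEquiv) ((B.endConjugate σ.toRingEquiv).comp ιB)),
      ∀ u v : K,
        ideleMulEquiv (reflexNormFinitePart K Φ (traceField Φ) s)⁻¹ (𝔞 : FractionalIdeal (𝓞 K)⁰ K) 𝔞.ne_zero
            (Submodule.Quotient.mk u) = Submodule.Quotient.mk v →
          B.conjPoints σ.toRingEquiv (ξB.r u) = ξ'.r v := by
  -- S5b: a balanced divisor `X` on `A₀ := A₁ ⊗ L′`, `L′ ⊇ L` finite inside `ℂ`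
  obtain ⟨L', hfin, X, hX⟩ := h5b K Φ L A₁ ι₁ hA₁
  haveI : FiniteDimensional L L' := hfin
  haveI : NumberField L' := NumberField.of_module_finite L L'
  have hA₀ : IsCMTypeRealisationOver Φ (A₁.baseChange L') ((A₁.endBaseChange L').comp ι₁) := hA₁.baseChange
  -- `ξ₀ := e⁻¹ ∘ ξ₁` along the tower isomorphism `e : (A₁ ⊗ L′) ⊗ ℂ ≅ A₁ ⊗ ℂ`
  obtain ⟨ξ₀⟩ : Nonempty (CMTypeUniformization Φ 𝔞 ((A₁.baseChange L').baseChange ℂ)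
      (((A₁.baseChange L').endBaseChange ℂ).comp ((A₁.endBaseChange L').comp ι₁))) :=
    ⟨ξ₁.ofIso (baseChangeTowerIso L L' ℂ A₁).symm (CMTypeUniformization.comm_symm_of_comm _
      (fun a => endBaseChange_baseChange_comp_baseChangeTowerIso_hom a))⟩
  -- the projections, as variables pinned by equations, and the dominance instances
  obtain ⟨πA, hπA⟩ : ∃ π : ((A₁.baseChange L').baseChange ℂ).X.left ⟶ (A₁.baseChange L').X.left,
      π = pullback.fst (A₁.baseChange L').X.hom (bcSpec L' ℂ) := ⟨_, rfl⟩
  haveI : IsDominant πA := by rw [hπA]; exact (A₁.baseChange L').isDominant_baseChangeFst ℂ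
  obtain ⟨πσ, hπσ⟩ : ∃ π : (((A₁.baseChange L').baseChange ℂ).conjugate σ.toRingEquiv).X.left ⟶
      ((A₁.baseChange L').baseChange ℂ).X.left,
      π = baseChangeHomFst σ.toRingEquiv.toRingHom ((A₁.baseChange L').baseChange ℂ).X := ⟨_, rfl⟩
  haveI : IsDominant πσ := by rw [hπσ]; exact isDominant_baseChangeHomFst σ.toRingEquiv _
  haveI hdomA : ∀ k : ℕ,
      IsDominant (Hom.toSchemeHom (((2 ^ k : ℕ) : ℤ) • 𝟙 ((A₁.baseChange L').baseChange ℂ))) := fun k =>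
    isDominant_toSchemeHom_zsmul_of_ne_zero _ (Nat.cast_ne_zero.2 (pow_ne_zero k two_ne_zero))
  haveI hdomσ : ∀ k : ℕ, IsDominant (Hom.toSchemeHom
      (((2 ^ k : ℕ) : ℤ) • 𝟙 (((A₁.baseChange L').baseChange ℂ).conjugate σ.toRingEquiv))) := fun k =>
    isDominant_toSchemeHom_zsmul_of_ne_zero _ (Nat.cast_ne_zero.2 (pow_ne_zero k two_ne_zero))
  haveI : Fact (Nat.Prime 2) := ⟨Nat.prime_two⟩
  -- S5b's clauses (bal), (nd) at `ℓ = 2`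
  obtain ⟨hros, c, hrad⟩ := hX πA hπA 2 one_lt_two
  -- S7a: `ν` and the level uniformisations; `ξ′ := ξ′_6`
  obtain ⟨ν, hν⟩ := h7a Φ 𝔞 (ideleMulIdealUnits (reflexNormFinitePart K Φ (traceField Φ) s)⁻¹ 𝔞)
    (A₁.baseChange L') ((A₁.endBaseChange L').comp ι₁) hA₀ X πA hπA ξ₀ σ s hs rfl πσ hπσ 2
  obtain ⟨ξ', q, β, hLU⟩ := hν 6 (by norm_num) ⟨3, rfl⟩
  refine ⟨(A₁.baseChange L').baseChange ℂ, _, ξ₀, ξ', fun u v huv => ?_⟩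
  -- `u ∈ (6d)⁻¹𝔞`: clause (2) at level `6d`, then glue `ξ′_{6d} = ξ′_6`
  obtain ⟨d, hd, hdu⟩ := exists_nat_mul_mem_fractionalIdeal (𝔞 : FractionalIdeal (𝓞 K)⁰ K) 𝔞.ne_zero u
  obtain ⟨ξ'', q', β', hLU'⟩ := hν (6 * d) (by positivity) (dvd_mul_of_dvd_left ⟨3, rfl⟩ d)
  have hu : (((6 * d : ℕ) : ℕ) : K) * u ∈ (𝔞 : FractionalIdeal (𝓞 K)⁰ K) := by
    have h6 : (((6 * d : ℕ) : ℕ) : K) * u = (6 : 𝓞 K) • ((d : K) * u) := by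
      rw [Algebra.smul_def, map_ofNat]; push_cast; ring
    rw [h6]
    exact Submodule.smul_mem _ _ hdu
  obtain ⟨h2, -⟩ := id hLU'
  rw [h2 u v hu huv]
  exact h7b Φ 𝔞 _ (A₁.baseChange L') ((A₁.endBaseChange L').comp ι₁) X πA hπA ξ₀ σ s rfl πσ hπσ 2 hros c hrad
    ν 6 (6 * d) (by norm_num) (Nat.dvd_mul_right 6 d) ⟨3, rfl⟩ ξ' ξ'' q q' β β' hLU hLU' v

/-! ### S7c -/

/-- **S7c «model reduction» (Shimura 1998, proof of Thm. 18.6: p. 128 / p. 165 «we may assume that `A`, `ι` are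
rational over an algebraic number field», p. 168 «Let `X` be a basic polar divisor», p. 169 «replace `M` by its
multiple `N` … `ξ′ = ξ″`»).**  Prop. 26 (W(ii): a number-field model of a structure of type `(K, Φ, 𝔞)`), S5b (a
balanced divisor over a finite extension), S7a (the level-`N` structure) and S7b (gluing two levels) imply the main
theorem of complex multiplication `shimura1998_thm18_6` (clauses (1) [type, lattice `g(s)⁻¹𝔞`] and (2)): the model
case `exists_model_uniformization_conjugate` transferred to the given `(A, ι, ξ)` along the `𝓞_K`-isomorphism of
§7.4 Prop. 17 (`exists_iso_forall_map_r_eq`, `b = 1`) and its conjugate (`exists_uniformization_conjugate_of_iso`).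
[cite: Shimura1998, §18.6 Thm. 18.6 (p. 127) and its proof, pp. 128, 165, 168–169; §7.4 Prop. 17 (p. 58)] -/
theorem modelReduction_holds : modelReduction := by
  intro h26 h5b h7a h7b K _ _ _ Φ _ 𝔞 A ι ξ σ s hs
  -- W(ii): a number-field model `(A₁, ι₁)` with `A₁ ⊗ ℂ` of type `(K, Φ, 𝔞)` w.r.t. `ξ₁`
  obtain ⟨k₁, i₁, i₂, i₃, A₁, ι₁, hA₁, ⟨ξ₁⟩⟩ :=
    exists_isCMTypeRealisationOver_uniformization_of_prop26 h26 Φ 𝔞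
  -- the model case
  obtain ⟨B, ιB, ξB, ξB', hB⟩ :=
    exists_model_uniformization_conjugate h5b h7a h7b Φ 𝔞 A₁ ι₁ hA₁ ξ₁ σ s hs
  -- same type `(K, Φ, 𝔞)` ⇒ an `𝓞_K`-isomorphism `e : B ≅ A` with `e(r_B(u)) = r(u)` (Prop. 17, `b = 1`)
  obtain ⟨e, he, her⟩ := ξB.exists_iso_forall_map_r_eq ξ (one_ne_zero (α := K))
    (by rw [FractionalIdeal.spanSingleton_one, one_mul])
  exact exists_uniformization_conjugate_of_iso ξB ξ e he (fun u => by rw [her u, one_mul]) σ.toRingEquiv _ ξB' hB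

end Literature.NumberTheory.ComplexMultiplication

end
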